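import Mathlib
import Summits.BirchSwinnertonDyer.BirchSwinnertonDyer.Theorems.ResidualThetaTransportAtTwoSignedMuSeedAtTwoPlusNonsquareDescentCapitulationKernel
import Summits.BirchSwinnertonDyer.BirchSwinnertonDyer.Theorems.ResidualThetaTransportAtTwoSignedMuSeedAtTwoPlusNonsquareDescentHilbertNinetyTransfer
import HarnessLib

/-!
# Non-square descent — CAPITULATION READ ON THE LIMIT: `i_{n,m}(x) = pr_m(ν_{m,n}·x̃)` for any lift `x̃ ∈ X = lim A_k`, hence
# `#ker(A_n → A_m) = #ker(X/ω_nX → X/ω_mX)` as soon as `ker pr_k = ω_kX` (`k = n, m`) — the glue between the tree's class-group maps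
# (`classGroupExtend`, `classGroupNorm`: `i∘N = Σ_g g`, Neukirch III (1.6) (iv)) and `…CapitulationKernel` (line `nonsquare-descent`, stub S2) —
# seed crux `SignedMuSeedAtTwoPlus` stmt-BirchSwinnertonDyer-21438 (parent Kμ⁺ `SignedMuVanishingAtTwoPlus` stmt-BirchSwinnertonDyer-20689,
# route ResidualThetaTransportAtTwo), line card `Cruxes/SignedMuSeedAtTwoPlus/Lines/nonsquare-descent.md`

Cell `bsd-wall`, width seat `bsd-wall-rtt-p4-w2` g19 (`--supports`, closes nothing).  THEOREMS ONLY; BSD is not proved by this and nothing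
arithmetic is asserted: module algebra over a commutative ring.

Dictionary (nothing below depends on it).  `A_k = Cl(M_k)[2^∞]^χ` (additively, as `Λ'`-modules through the Galois action), `X = lim_← A_k` along
the norms with projections `pr_k : X ↠ A_k` (norms are onto in a totally ramified tower — tree `ClassGroupNormSurjective`), `N : A_m → A_n` the norm,
`i : A_n → A_m` the extension of ideals, `ν = ν_{m,n}`, `ω = ω_n`.  The tree supplies `pr_n = N ∘ pr_m` (compatibility) and `i ∘ N = ν•`
(`classGroupExtend_classGroupNorm_eq_prod`: `i(N c) = ∏_{g ∈ G_{m,n}} g·c`).  The ONE arithmetic input isolated here is Iwasawa's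
«`ker pr_k = ω_k X`» (unique totally ramified prime; Washington Prop. 13.22).  Then:

* §1 `extend_proj_eq` — **`i(pr_n x̃) = pr_m(ν x̃)`** (no surjectivity needed); `mem_ker_extend_iff`, **`ker_extend_eq`** —
  `ker i = pr_n(ν⁻¹(ker pr_m))` for `pr_n` onto.
* §2 with `ker pr_n = ωX`, `ker pr_m = νωX`: **`natCard_ker_extend_eq_natCard_ker_capitulation`** — `#ker i = #ker(x ↦ νx : X/ωX → X/νωX)`
  (commuting square, `…HilbertNinetyTransfer.natCard_ker_eq_of_square`), hence with `…CapitulationKernel`: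
  **`natCard_ker_extend_dvd`** (`#ker i ∣ #X[ν]`) and **`natCard_ker_extend_le`** (`#ker i ≤ #F_max` for `X` f.g. over Noetherian `R` with
  `X/νωX` finite) — «`#ker(A_n^χ → A_m^χ) ≤ #F^χ`, uniformly in `m`».

[folklore]
-/

set_option autoImplicit false
-- the Theorems namespace of this sub repeats the summit name by design (D-0017 nested layout)
set_option linter.dupNamespace false

open scoped Pointwise

namespace Summit.BirchSwinnertonDyer.BirchSwinnertonDyer.Theorems.SignedMuAtTwo.NonsquareDescent

universe u v w w'

variable {R : Type u} [CommRing R] {X : Type v} [AddCommGroup X] [Module R X]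
  {An : Type w} [AddCommGroup An] [Module R An] {Am : Type w'} [AddCommGroup Am] [Module R Am]
  (prn : X →ₗ[R] An) (prm : X →ₗ[R] Am) (Nm : Am →ₗ[R] An) (i : An →ₗ[R] Am) {ω ν : R}

/-! ## §1 The extension map read on the limit -/

/-- **`i(pr_n x̃) = pr_m(ν·x̃)`**: from `pr_n = N ∘ pr_m` and `i ∘ N = ν•`. [folklore] -/
theorem extend_proj_eq (hcomp : ∀ x : X, Nm (prm x) = prn x) (hiN : ∀ a : Am, i (Nm a) = ν • a) (x : X) :
    i (prn x) = prm (ν • x) := by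
  rw [← hcomp, hiN, map_smul]

/-- `a ∈ ker i ↔ ∃ x̃` over `a` with `ν x̃ ∈ ker pr_m`, for `pr_n` onto. [folklore] -/
theorem mem_ker_extend_iff (hcomp : ∀ x : X, Nm (prm x) = prn x) (hiN : ∀ a : Am, i (Nm a) = ν • a)
    (hprn : Function.Surjective prn) (a : An) :
    a ∈ LinearMap.ker i ↔ ∃ x : X, prn x = a ∧ prm (ν • x) = 0 := by
  constructor
  · intro ha
    obtain ⟨x, rfl⟩ := hprn a
    refine ⟨x, rfl, ?_⟩
    rw [← extend_proj_eq prn prm Nm i hcomp hiN x]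
    exact ha
  · rintro ⟨x, rfl, hx⟩
    rw [LinearMap.mem_ker, extend_proj_eq prn prm Nm i hcomp hiN x, hx]

/-- **`ker i = pr_n(ν⁻¹(ker pr_m))`** for `pr_n` onto. [folklore] -/
theorem ker_extend_eq (hcomp : ∀ x : X, Nm (prm x) = prn x) (hiN : ∀ a : Am, i (Nm a) = ν • a)
    (hprn : Function.Surjective prn) :
    LinearMap.ker i = ((LinearMap.ker prm).comap (DistribSMul.toLinearMap R X ν)).map prn := by
  ext a
  rw [mem_ker_extend_iff prn prm Nm i hcomp hiN hprn, Submodule.mem_map]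
  constructor
  · rintro ⟨x, rfl, hx⟩
    exact ⟨x, by rw [Submodule.mem_comap, DistribSMul.toLinearMap_apply, LinearMap.mem_ker, hx], rfl⟩
  · rintro ⟨x, hx, rfl⟩
    rw [Submodule.mem_comap, DistribSMul.toLinearMap_apply, LinearMap.mem_ker] at hx
    exact ⟨x, rfl, hx⟩

/-! ## §2 With Iwasawa's `ker pr_k = ω_kX`: `#ker i = #ker(X/ωX → X/νωX)` -/

section Iwasawa

/-- `pr_n` onto with kernel `ωX` identifies `A_n` with `X/ωX`: the induced equivalence, on classes. [folklore] -/
theorem quotKerEquiv_proj_apply (hprn : Function.Surjective prn) (hkn : LinearMap.ker prn = ω • (⊤ : Submodule R X)) (x : X) :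
    ((Submodule.quotEquivOfEq _ _ hkn.symm).trans (LinearMap.quotKerEquivOfSurjective prn hprn)) (Submodule.Quotient.mk x) = prn x := by
  rw [LinearEquiv.trans_apply, Submodule.quotEquivOfEq_mk]
  exact LinearMap.quotKerEquivOfSurjective_apply_mk prn hprn x

/-- **`#ker(i : A_n → A_m) = #ker(x ↦ νx : X/ωX → X/νωX)`** when `pr_n`, `pr_m` are onto with kernels `ωX`, `νωX` (Iwasawa's identification for a
tower with one totally ramified prime), `pr_n = N ∘ pr_m` and `i ∘ N = ν•`. [folklore] -/
theorem natCard_ker_extend_eq_natCard_ker_capitulation (hcomp : ∀ x : X, Nm (prm x) = prn x) (hiN : ∀ a : Am, i (Nm a) = ν • a)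
    (hprn : Function.Surjective prn) (hprm : Function.Surjective prm)
    (hkn : LinearMap.ker prn = ω • (⊤ : Submodule R X)) (hkm : LinearMap.ker prm = (ν * ω) • (⊤ : Submodule R X)) :
    Nat.card (LinearMap.ker i) =
      Nat.card (LinearMap.ker (Submodule.mapQ (ω • (⊤ : Submodule R X)) ((ν * ω) • (⊤ : Submodule R X))
        (DistribSMul.toLinearMap R X ν) (smul_top_le_comap_lsmul ω ν))) := by
  symm
  refine natCard_ker_eq_of_square _ i
    ((Submodule.quotEquivOfEq _ _ hkn.symm).trans (LinearMap.quotKerEquivOfSurjective prn hprn))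
    (((Submodule.quotEquivOfEq _ _ hkm.symm).trans (LinearMap.quotKerEquivOfSurjective prm hprm)).toLinearMap)
    (((Submodule.quotEquivOfEq _ _ hkm.symm).trans (LinearMap.quotKerEquivOfSurjective prm hprm)).injective) fun a => ?_
  obtain ⟨x, rfl⟩ := Submodule.mkQ_surjective _ a
  rw [Submodule.mkQ_apply, Submodule.mapQ_apply, LinearEquiv.coe_toLinearMap, quotKerEquiv_proj_apply prm hprm hkm,
    quotKerEquiv_proj_apply prn hprn hkn, DistribSMul.toLinearMap_apply, extend_proj_eq prn prm Nm i hcomp hiN x]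

/-- **`#ker(A_n → A_m) ∣ #X[ν_{m,n}]`** under the same hypotheses (any commutative ring). [folklore] -/
theorem natCard_ker_extend_dvd (hcomp : ∀ x : X, Nm (prm x) = prn x) (hiN : ∀ a : Am, i (Nm a) = ν • a)
    (hprn : Function.Surjective prn) (hprm : Function.Surjective prm)
    (hkn : LinearMap.ker prn = ω • (⊤ : Submodule R X)) (hkm : LinearMap.ker prm = (ν * ω) • (⊤ : Submodule R X)) :
    Nat.card (LinearMap.ker i) ∣ Nat.card (Submodule.torsionBy R X ν) := by
  rw [natCard_ker_extend_eq_natCard_ker_capitulation prn prm Nm i hcomp hiN hprn hprm hkn hkm]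
  exact natCard_ker_capitulation_dvd ω ν

/-- **`#ker(A_n → A_m) ≤ #F_max`** — the capitulation kernel is bounded by the maximal finite submodule of `X`, uniformly in `m`: `X` finitely generated
over a Noetherian `R`, `A_m ≅ X/νωX` finite, `F` a finite submodule containing every finite submodule (`…CapitulationKernel.exists_maximal_finite_submodule`).
(«`#ker(A_n^χ → A_m^χ) ≤ #F^χ`».) [folklore] -/
theorem natCard_ker_extend_le [IsNoetherianRing R] [Module.Finite R X] (hcomp : ∀ x : X, Nm (prm x) = prn x)
    (hiN : ∀ a : Am, i (Nm a) = ν • a) (hprn : Function.Surjective prn) (hprm : Function.Surjective prm)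
    (hkn : LinearMap.ker prn = ω • (⊤ : Submodule R X)) (hkm : LinearMap.ker prm = (ν * ω) • (⊤ : Submodule R X))
    [Finite Am] {F : Submodule R X} (hFfin : Finite F) (hF : ∀ F' : Submodule R X, Finite F' → F' ≤ F) :
    Nat.card (LinearMap.ker i) ≤ Nat.card F := by
  haveI : Finite (X ⧸ (ν * ω) • (⊤ : Submodule R X)) :=
    Finite.of_equiv Am ((Submodule.quotEquivOfEq _ _ hkm.symm).trans (LinearMap.quotKerEquivOfSurjective prm hprm)).toEquiv.symm
  rw [natCard_ker_extend_eq_natCard_ker_capitulation prn prm Nm i hcomp hiN hprn hprm hkn hkm]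
  exact natCard_ker_capitulation_le ω ν hFfin hF

end Iwasawa

end Summit.BirchSwinnertonDyer.BirchSwinnertonDyer.Theorems.SignedMuAtTwo.NonsquareDescent
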